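import Mathlib
import Literature.Geometry.DiscreteGeometry.KissingPatterns
import Summits.AtomisticToContinuum.Crystallization.Theorems.DisclinationRationFiveFoldRationStubPoleLemmaCore

/-!
# Crux `DisclinationRation.FiveFoldRation` (stmt-AtomisticToContinuum-15799), line `Sketch` —
# stub `stub_dr5_links`: links = pattern adjacency (front end 3)

Links (front end 3), from shell symmetry (as hypothesis BY STATEMENT): for ANY pattern `P` of
unit vectors, pairwise `≥ 1` apart and with no pair distance in `(26/25, 7/5)`, and any
`1/20`-matching `e` of the shell of `y ∈ S` onto `P`, two distinct shell-mates `t, t'` of `y` are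
shell-adjacent (`t' ∈ Sh S t`) iff their pattern images are adjacent
(`dist (e t) (e t') ≤ 26/25`).

Proof (`dr5lk_core`, everything written out; the stub is its specialisation by `exact`).  Write
`d_x = sInf ((fun w => dist w x) '' (S \ {x}))`.  The tolerance and the isometry `A` give
`|dist t t' / d_y − dist (e t) (e t')| ≤ 1/10` (`dr5pl_img_dist_le`, `dr5pl_dist_le_of_tol` of
`…StubPoleLemmaCore`), and shell symmetry at `(y, t)` gives `d_y ≤ dist t y ≤ 21/20 · d_y`,
`dist y t ≤ 21/20 · d_t`, whence `20/21 · d_y ≤ d_t ≤ 21/20 · d_y`.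
(⇐) `dist (e t) (e t') ≤ 26/25` gives
`dist t' t ≤ 57/50 · d_y < 26/21 · d_y ≤ 13/10 · d_t`.
(⇒) `t' ∈ Sh S t` gives, by shell symmetry at `(t, t')`,
`dist t' t ≤ 21/20 · d_t ≤ 441/400 · d_y`, so `dist (e t) (e t') ≤ 481/400 < 7/5`, and the
gap hypothesis on `P` forces `≤ 26/25`.
Helper prefix `dr5lk_`.

Registered signature: `Cruxes/FiveFoldRation/Lines/Sketch.lean` (v3), `let`-abbreviated style
(`Dc`, `nd`, `Sh`, `F`, `H`, `Tol`).
-/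

noncomputable section

namespace Summit.AtomisticToContinuum.Crystallization.Theorems

/-- **Links = pattern adjacency, core form.** For `S` `δ`-separated with the shell-symmetry
conclusions at hand (hypothesis `hSM`, the statement of stub `stub_dr5_shellMutual` specialised
to `S`, written out), a pattern `P` with no pair distance in `(26/25, 7/5)`, and a `1/20`-matching
`(A, e)` of the shell of `y ∈ S` onto `P`: two distinct shell-mates `t, t'` of `y` are
shell-adjacent iff their pattern images are at distance `≤ 26/25`.  Terms are written out (no
local notations): `d_x = sInf ((fun w => dist w x) '' (S \ {x}))`, the shell of `x` is
`{z | z ∈ S ∧ z ≠ x ∧ dist z x < 13/10 · d_x}`. -/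
theorem dr5lk_core {S : Set (EuclideanSpace ℝ (Fin 3))} {δ : ℝ} (hδ : 0 < δ)
    (hsep : ∀ y ∈ S, ∀ z ∈ S, y ≠ z → δ ≤ dist y z)
    (hSM : ∀ y ∈ S, ∀ z ∈ S, z ≠ y →
      dist z y < 13 / 10 * sInf ((fun w => dist w y) '' (S \ {y})) →
      sInf ((fun w => dist w y) '' (S \ {y})) ≤ dist z y ∧
        dist z y ≤ 21 / 20 * sInf ((fun w => dist w y) '' (S \ {y})) ∧
        dist y z < 13 / 10 * sInf ((fun w => dist w z) '' (S \ {z})) ∧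
        dist y z ≤ 21 / 20 * sInf ((fun w => dist w z) '' (S \ {z})))
    {P : Set (EuclideanSpace ℝ (Fin 3))}
    (hgap : ∀ p ∈ P, ∀ q ∈ P, dist p q ≤ 26 / 25 ∨ 7 / 5 ≤ dist p q)
    {y : EuclideanSpace ℝ (Fin 3)} (hy : y ∈ S)
    (A : EuclideanSpace ℝ (Fin 3) →ₗᵢ[ℝ] EuclideanSpace ℝ (Fin 3))
    (e : ↥{z : EuclideanSpace ℝ (Fin 3) | z ∈ S ∧ z ≠ y ∧
      dist z y < 13 / 10 * sInf ((fun w => dist w y) '' (S \ {y}))} ≃ ↥P)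
    (htol : ∀ t : ↥{z : EuclideanSpace ℝ (Fin 3) | z ∈ S ∧ z ≠ y ∧
      dist z y < 13 / 10 * sInf ((fun w => dist w y) '' (S \ {y}))},
      dist ((sInf ((fun w => dist w y) '' (S \ {y})))⁻¹ • (t.1 - y)) (A (e t).1) ≤ 1 / 20)
    (t t' : ↥{z : EuclideanSpace ℝ (Fin 3) | z ∈ S ∧ z ≠ y ∧
      dist z y < 13 / 10 * sInf ((fun w => dist w y) '' (S \ {y}))})
    (hne : t ≠ t') :
    (t'.1 ∈ {z : EuclideanSpace ℝ (Fin 3) | z ∈ S ∧ z ≠ t.1 ∧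
        dist z t.1 < 13 / 10 * sInf ((fun w => dist w t.1) '' (S \ {t.1}))} ↔
      dist (e t).1 (e t').1 ≤ 26 / 25) := by
  -- `d_x ≤ dist z x` for `z ∈ S \ {x}`
  have hinf : ∀ x z : EuclideanSpace ℝ (Fin 3), z ∈ S → z ≠ x →
      sInf ((fun w => dist w x) '' (S \ {x})) ≤ dist z x := fun x z hz hzx =>
    csInf_le ⟨0, by rintro _ ⟨w, -, rfl⟩; exact dist_nonneg⟩ ⟨z, ⟨hz, hzx⟩, rfl⟩
  obtain ⟨htS, hty, htd⟩ := t.2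
  obtain ⟨ht'S, -, -⟩ := t'.2
  -- `0 < δ ≤ d_y`
  have hδy : δ ≤ sInf ((fun w => dist w y) '' (S \ {y})) := by
    refine le_csInf ⟨_, ⟨t.1, ⟨htS, hty⟩, rfl⟩⟩ ?_
    rintro _ ⟨z, ⟨hzS, hzy⟩, rfl⟩
    show δ ≤ dist z y
    rw [dist_comm]
    exact hsep y hy z hzS (fun h => hzy h.symm)
  have hdy : 0 < sInf ((fun w => dist w y) '' (S \ {y})) := lt_of_lt_of_le hδ hδy
  -- shell symmetry at `(y, t)`: `20/21 · d_y ≤ d_t ≤ 21/20 · d_y`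
  obtain ⟨h1, h2, -, h4⟩ := hSM y hy t.1 htS hty htd
  have hdt_ge : 20 / 21 * sInf ((fun w => dist w y) '' (S \ {y})) ≤
      sInf ((fun w => dist w t.1) '' (S \ {t.1})) := by
    rw [dist_comm] at h4
    linarith
  have hdt_le : sInf ((fun w => dist w t.1) '' (S \ {t.1})) ≤
      21 / 20 * sInf ((fun w => dist w y) '' (S \ {y})) := by
    have hyt : sInf ((fun w => dist w t.1) '' (S \ {t.1})) ≤ dist y t.1 := hinf t.1 y hy hty.symm
    rw [dist_comm] at hyt
    linarith
  have htt' : t'.1 ≠ t.1 := fun h => hne (Subtype.ext h).symm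
  -- tolerance algebra: `|dist t t' / d_y - dist (e t) (e t')| ≤ 1/10`
  have hup : dist (e t).1 (e t').1 ≤
      (sInf ((fun w => dist w y) '' (S \ {y})))⁻¹ * dist t.1 t'.1 + 1 / 10 :=
    dr5pl_img_dist_le (inv_nonneg.2 hdy.le) A (htol t) (htol t')
  have hlow : dist t.1 t'.1 ≤
      sInf ((fun w => dist w y) '' (S \ {y})) * (dist (e t).1 (e t').1 + 1 / 10) := by
    have := dr5pl_dist_le_of_tol (inv_pos.2 hdy) A (htol t) (htol t')
    rwa [inv_inv] at this
  constructor
  · rintro ⟨-, -, hlt⟩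
    -- shell symmetry at `(t, t')`: `dist t' t ≤ 21/20 · d_t ≤ 441/400 · d_y`
    obtain ⟨-, h2', -, -⟩ := hSM t.1 htS t'.1 ht'S htt' hlt
    have hb : dist t.1 t'.1 ≤ sInf ((fun w => dist w y) '' (S \ {y})) * (441 / 400) := by
      rw [dist_comm]
      nlinarith
    have hq : (sInf ((fun w => dist w y) '' (S \ {y})))⁻¹ * dist t.1 t'.1 ≤ 441 / 400 := by
      rw [inv_mul_le_iff₀ hdy]
      exact hb
    rcases hgap _ (e t).2 _ (e t').2 with h | h
    · exact h
    · exfalso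
      linarith
  · intro h
    -- `dist t' t ≤ 57/50 · d_y < 26/21 · d_y ≤ 13/10 · d_t`
    refine ⟨ht'S, htt', ?_⟩
    have h57 : dist t.1 t'.1 ≤ sInf ((fun w => dist w y) '' (S \ {y})) * (26 / 25 + 1 / 10) :=
      le_trans hlow (mul_le_mul_of_nonneg_left (by linarith) hdy.le)
    show dist t'.1 t.1 < 13 / 10 * sInf ((fun w => dist w t.1) '' (S \ {t.1}))
    rw [dist_comm]
    linarith

/-- Links (front end 3), from shell symmetry (as hypothesis BY STATEMENT): for ANY pattern `P` of unit vectors, pairwise `≥ 1` apart and with no pair distance in `(26/25, 7/5)`, and any `1/20`-matching `e` of the shell of `y ∈ S` onto `P`, two distinct shell-mates `t, t'` of `y` are shell-adjacent (`t' ∈ Sh S t`) iff their pattern images are adjacent (`dist (e t) (e t') ≤ 26/25`). -/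
theorem stub_dr5_links : (let Dc := {p : EuclideanSpace ℝ (Fin 3) | p = !₂[(0 : ℝ), 0, 1] ∨ p = !₂[(0 : ℝ), 0, -1] ∨ ∃ k : Fin 5, ∃ σ : ℝ, (σ = 1 / 2 ∨ σ = -(1 / 2)) ∧ p = !₂[Real.sqrt 3 / 2 * Real.cos (2 * Real.pi * (k : ℝ) / 5), Real.sqrt 3 / 2 * Real.sin (2 * Real.pi * (k : ℝ) / 5), σ]}; let nd := fun (S : Set (EuclideanSpace ℝ (Fin 3))) (y : EuclideanSpace ℝ (Fin 3)) => sInf ((fun z => dist z y) '' (S \ {y})); let Sh := fun (S : Set (EuclideanSpace ℝ (Fin 3))) (y : EuclideanSpace ℝ (Fin 3)) => {z : EuclideanSpace ℝ (Fin 3) | z ∈ S ∧ z ≠ y ∧ dist z y < 13 / 10 * nd S y}; let F := fun (S : Set (EuclideanSpace ℝ (Fin 3))) (y : EuclideanSpace ℝ (Fin 3)) (A : EuclideanSpace ℝ (Fin 3) →ₗᵢ[ℝ] EuclideanSpace ℝ (Fin 3)) => ∃ e : ↥(Sh S y) ≃ ↥Literature.Geometry.DiscreteGeometry.fccKissingPattern,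 ∀ t : ↥(Sh S y), dist ((nd S y)⁻¹ • (t.1 - y)) (A (e t).1) ≤ 1 / 20; let H := fun (S : Set (EuclideanSpace ℝ (Fin 3))) (y : EuclideanSpace ℝ (Fin 3)) (A : EuclideanSpace ℝ (Fin 3) →ₗᵢ[ℝ] EuclideanSpace ℝ (Fin 3)) => ∃ e : ↥(Sh S y) ≃ ↥Literature.Geometry.DiscreteGeometry.hcpKissingPattern, ∀ t : ↥(Sh S y), dist ((nd S y)⁻¹ • (t.1 - y)) (A (e t).1) ≤ 1 / 20; let Tol := fun (S : Set (EuclideanSpace ℝ (Fin 3))) (y : EuclideanSpace ℝ (Fin 3)) (A : EuclideanSpace ℝ (Fin 3) →ₗᵢ[ℝ] EuclideanSpace ℝ (Fin 3)) (e : ↥(Sh S y) ≃ ↥Dc) => ∀ t : ↥(Sh S y), dist ((nd S y)⁻¹ • (t.1 - y)) (A (e t).1) ≤ 1 / 20; (∀ δ : ℝ, 0 < δ → ∀ S : Set (EuclideanSpace ℝ (Fin 3)), (∀ y ∈ S, ∀ z ∈ S, y ≠ z → δ ≤ dist y z) → (∃ R₁ : ℝ, ∀ p : EuclideanSpace ℝ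 (Fin 3), ∃ y ∈ S, dist y p ≤ R₁) → (∀ y ∈ S, ∃ A : EuclideanSpace ℝ (Fin 3) →ₗᵢ[ℝ] EuclideanSpace ℝ (Fin 3), F S y A ∨ H S y A ∨ ∃ e : ↥(Sh S y) ≃ ↥Dc, Tol S y A e) → ∀ y ∈ S, ∀ z ∈ S, z ≠ y → dist z y < 13 / 10 * nd S y → nd S y ≤ dist z y ∧ dist z y ≤ 21 / 20 * nd S y ∧ dist y z < 13 / 10 * nd S z ∧ dist y z ≤ 21 / 20 * nd S z) → (∀ δ : ℝ, 0 < δ → ∀ S : Set (EuclideanSpace ℝ (Fin 3)), (∀ y ∈ S, ∀ z ∈ S, y ≠ z → δ ≤ dist y z) → (∃ R₁ : ℝ, ∀ p : EuclideanSpace ℝ (Fin 3), ∃ y ∈ S, dist y p ≤ R₁) → (∀ y ∈ S, ∃ A : EuclideanSpace ℝ (Fin 3) →ₗᵢ[ℝ] EuclideanSpace ℝ (Fin 3), F S y A ∨ H S y A ∨ ∃ e : ↥(Sh S y) ≃ ↥Dc, Tol S y A e) → ∀ P : Set (EuclideanSpace ℝ (Fin 3)), (∀ p ∈ P, ‖p‖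 = 1) → (∀ p ∈ P, ∀ q ∈ P, p ≠ q → 1 ≤ dist p q) → (∀ p ∈ P, ∀ q ∈ P, dist p q ≤ 26 / 25 ∨ 7 / 5 ≤ dist p q) → ∀ y ∈ S, ∀ A : EuclideanSpace ℝ (Fin 3) →ₗᵢ[ℝ] EuclideanSpace ℝ (Fin 3), ∀ e : ↥(Sh S y) ≃ ↥P, (∀ t : ↥(Sh S y), dist ((nd S y)⁻¹ • (t.1 - y)) (A (e t).1) ≤ 1 / 20) → ∀ t t' : ↥(Sh S y), t ≠ t' → (t'.1 ∈ Sh S t.1 ↔ dist (e t).1 (e t').1 ≤ 26 / 25))) := by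
  intro Dc nd Sh F H Tol hSM δ hδ S hsep hRD hgood P _hnorm _hone hgap y hy A e htol t t' hne
  exact dr5lk_core hδ hsep
    (fun y' hy' z hz hzy hlt => hSM δ hδ S hsep hRD hgood y' hy' z hz hzy hlt) hgap hy A e htol
    t t' hne

end Summit.AtomisticToContinuum.Crystallization.Theorems

end
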